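import Literature.Analysis.FluidPDE.VortexStretchingDynamics
import Mathlib.Analysis.InnerProductSpace.Calculus
import Mathlib.Analysis.Calculus.Deriv.Inv
import HarnessLib

/-!
# The Lagrangian `(α, χ)` dynamics for Euler: `Dα/Dt = χ² − α² − α_p`, `Dχ/Dt = −2αχ − χ_p`
# (Galanti–Gibbon–Heritage 1997, §2 (conv1), (alphaev1), (chiidef); the `|ω|`-equation (const))

Analysis/FluidPDE proof file (theorems only; no definitions, no named facts), third part of the
GGH97 bracket: `VorticityDirectionDynamics.lean` (§3: `|ω|`, `ξ`), `VortexStretchingDynamics.lean`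
(§1–§2: `Dσ/Dt = −Pω`, `D(ω × σ)/Dt = −ω × Pω`), `BurgersVortexTiltingFree.lean` (§4).

## What is printed

B. Galanti, J. D. Gibbon, M. Heritage, Nonlinearity 10 (1997) 1675–1694 = arXiv:chao-dyn/9709003,
§1 p. 3 and §2 p. 5 (render `paper-arxiv-chao-dyn_9709003/p0003.txt`, `p0005.txt`), verbatim:
"`α(x,t) = ξ·Sξ = ω·Sω/ω·ω` ((alphadef)) … For the three-dimensional Euler equations, the scalar
vorticity `ω = |ω|` simply obeys ((const)) `Dω/Dt = αω`"; "`χ = ξ × Sξ = ω × Sω/ω·ω`"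
((chidefintro)); §2: "`α_p(x,t) = ξ·Pξ`" ((evSP)); "To obtain relations between these
quantities we firstly note that ((conv1)) `D(ω·σ)/Dt = σ² − ω·Pω = ω²(α² sec²φ − α_p)` whereas
in the cross product, the terms in `σ` vanish leaving only ((conv2)) `D(ω × σ)/Dt = −ω × Pω` …
The material derivatives of `α` and `χ` can now easily be obtained … ((alphaev1))
**`Dα/Dt = χ² − α² − α_p`**, ((chiidef)) `Dχ/Dt = −2αχ − χ_p`" — "the main results of the paper"
(§1 p. 4, (alphaev)/(chi0)).

## What is here (Euler, pointwise at `(t, x)`; `ω = curl u`, `σ = ∇u ω = Sω`,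
`D/Dt = ∂ₜ + (u·∇)` with the convective part written `fderiv ℝ (·) x (u t x)` of the spatial field)

Hypotheses as in `VortexStretchingDynamics.hasDerivAt_stretching_euler`: `uncurry u` is `C²` at
`(t, x)`, `p(t,·)` is `C²` at `x`, the Euler momentum equation `∂ₜu = −(u·∇)u − ∇p` holds near `x`
at time `t`, and the vorticity equation `∂ₜω = −(u·∇)ω + (ω·∇)u` holds at `(t, x)`.

* `hasDerivAt_norm_curl_sq_euler` — **`D|ω|²/Dt = 2 ω·σ`** (`= 2α|ω|²`, (const) squared);
* `hasDerivAt_inner_curl_stretching_euler` — **(conv1) `D(ω·σ)/Dt = |σ|² − ω·Pω`**;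
* `norm_cross_sq` — Lagrange's identity `|ω × σ|² = |ω|²|σ|² − (ω·σ)²`, i.e.
  `|σ|²/|ω|² = α² + χ²` (the (cos) step, `cos²φ = ω²α²/σ²`);
* **`hasDerivAt_stretchingRate_euler`** — **(alphaev1) `Dα/Dt = χ² − α² − α_p`** at points with
  `ω ≠ 0`, with `α = ω·σ/|ω|²`, `χ² = |ω × σ|²/|ω|⁴`, `α_p = ω·Pω/|ω|²` written out;
* **`hasDerivAt_tiltingVector_euler`** — **(chiidef) `Dχ/Dt = −2αχ − χ_p`** (vector form,
  `χ = ω × σ/|ω|²`, `χ_p = ω × Pω/|ω|²`) at points with `ω ≠ 0`.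

Deviations: GGH's `S` is replaced by the full gradient `∇u` acting on `ω` (the same vector `σ`,
and `ξ·∇u ξ = ξ·Sξ`, `ξ × ∇u ξ = ξ × Sξ` since the antisymmetric part acts as `½ω × ·`); the
Navier–Stokes versions ((extra1)/(extra2) with `λ`, `μ`) are not typed here — their viscous terms
are available raw from `VortexStretchingDynamics.hasDerivAt_stretching` and
`VorticityDirectionDynamics`. WHAT THIS IS NOT: no regularity claim; exact pointwise identities for
classical Euler solutions (the Lagrangian `(α, χ)` phase-plane language of nsreg-p1's S19).

## Tree / Mathlib search

Tree (used): `VortexStretchingDynamics.hasDerivAt_stretching_euler`, `fderiv_stretching_apply`,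
`curl_eq_curlCLM_comp`, `norm_cross` (`VectorCalculus`). Mathlib: `HasDerivAt.inner`,
`HasDerivAt.norm_sq`, `HasDerivAt.div`, `HasFDerivAt.inner`, `HasFDerivAt.norm_sq`,
`HasFDerivAt.mul`, `hasDerivAt_inv`, `InnerProductGeometry.cos_angle_mul_norm_mul_norm`.
Searched: `stretchingRate`, `hasDerivAt.*alpha`, `Lagrange`, `norm_cross_sq` — not in the tree
(only the angle form `norm_cross`).

## References

* B. Galanti, J. D. Gibbon, M. Heritage, Nonlinearity 10 (1997) 1675–1694 =
  arXiv:chao-dyn/9709003, §1 (alphadef), (const), (chidefintro); §2 (evSP), (conv1), (cos),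
  (alphaev1), (chiidef). [`GalantiGibbonHeritage1997`]
-/

noncomputable section

open Set Function Filter
open scoped RealInnerProductSpace Topology

namespace Literature.Analysis.FluidPDE

namespace VortexStretchingDynamics

/-! ### Lagrange's identity for the tree's cross product -/

/-- **Lagrange's identity** `‖a × b‖² = ‖a‖²‖b‖² − ⟪a, b⟫²` (from `‖a × b‖ = ‖a‖‖b‖ sin∠(a,b)`
and `cos∠(a,b)‖a‖‖b‖ = ⟪a,b⟫`); with `a = ω`, `b = σ = Sω` this is GGH's (cos):
`|σ|²/|ω|² = α² + χ²`. [cite: GalantiGibbonHeritage1997, §2 (cos) (arXiv:chao-dyn/9709003 p. 5)] -/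
theorem norm_cross_sq (a b : EuclideanSpace ℝ (Fin 3)) :
    ‖cross a b‖ ^ 2 = ‖a‖ ^ 2 * ‖b‖ ^ 2 - ⟪a, b⟫ ^ 2 := by
  rw [norm_cross, ← InnerProductGeometry.cos_angle_mul_norm_mul_norm, mul_pow, mul_pow, mul_pow,
    mul_pow, Real.sin_sq]
  ring

/-! ### Euler: `|ω|²`, `ω·σ` and the stretching rate along trajectories -/

section Euler

variable {u : ℝ → EuclideanSpace ℝ (Fin 3) → EuclideanSpace ℝ (Fin 3)}
  {p : ℝ → EuclideanSpace ℝ (Fin 3) → ℝ} {x : EuclideanSpace ℝ (Fin 3)} {t : ℝ}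

/-- A jointly `C²` family has `C²` time slices. [folklore] -/
private theorem contDiffAt_slice' (hu : ContDiffAt ℝ 2 (uncurry u) (t, x)) :
    ContDiffAt ℝ 2 (u t) x := by
  have h : ContDiffAt ℝ 2 (fun y : EuclideanSpace ℝ (Fin 3) => (t, y)) x :=
    contDiffAt_const.prodMk contDiffAt_id
  exact hu.comp x h

/-- Spatial differentiability of `ω = curl u(t,·)` and of `σ = ∇u ω` at `x` for a `C²` slice.
[folklore] -/
private theorem differentiableAt_curl_and_stretching (hut : ContDiffAt ℝ 2 (u t) x) :
    DifferentiableAt ℝ (curl (u t)) x ∧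
      DifferentiableAt ℝ (fun y => fderiv ℝ (u t) y (curl (u t) y)) x := by
  have hA1 : DifferentiableAt ℝ (fderiv ℝ (u t)) x :=
    (hut.fderiv_right (m := 1) (by norm_num)).differentiableAt (by simp)
  have hωd : DifferentiableAt ℝ (curl (u t)) x := by
    rw [curl_eq_curlCLM_comp]
    exact curlCLM.differentiableAt.comp x hA1
  exact ⟨hωd, hA1.clm_apply hωd⟩

/-- **`D|ω|²/Dt = 2 ω·σ` for Euler** (`σ = ∇u ω`; GGH (const) `D|ω|/Dt = α|ω|` in squared form,
`ω·σ = α|ω|²`): `∂ₜ|ω|² = −(u·∇)|ω|² + 2⟪ω, σ⟫` at `(t, x)`.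
[cite: GalantiGibbonHeritage1997, §1 (const) with (alphadef) (arXiv:chao-dyn/9709003 p. 3)] -/
theorem hasDerivAt_norm_curl_sq_euler (hu : ContDiffAt ℝ 2 (uncurry u) (t, x))
    (hvort : HasDerivAt (fun s => curl (u s) x)
      (-convect (u t) (curl (u t)) x + convect (curl (u t)) (u t) x) t) :
    HasDerivAt (fun s => ‖curl (u s) x‖ ^ 2)
      (-(fderiv ℝ (fun y => ‖curl (u t) y‖ ^ 2) x (u t x)) +
        2 * ⟪curl (u t) x, fderiv ℝ (u t) x (curl (u t) x)⟫) t := by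
  obtain ⟨hωd, -⟩ := differentiableAt_curl_and_stretching (contDiffAt_slice' hu)
  have hsp : fderiv ℝ (fun y => ‖curl (u t) y‖ ^ 2) x (u t x) =
      2 * ⟪curl (u t) x, fderiv ℝ (curl (u t)) x (u t x)⟫ := by
    rw [hωd.hasFDerivAt.norm_sq.fderiv]
    simp only [smul_apply, ContinuousLinearMap.coe_comp, Function.comp_apply, innerSL_apply_apply,
      nsmul_eq_mul, Nat.cast_ofNat]
  refine (hvort.norm_sq).congr_deriv ?_
  rw [hsp, convect_apply, convect_apply, inner_add_right, inner_neg_right]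
  ring

/-- **GGH97 (conv1) for Euler: `D(ω·σ)/Dt = |σ|² − ω·Pω`** (`σ = Sω = ∇u ω`, `P = ∇²p`):
`∂ₜ⟪ω, σ⟫ = −(u·∇)⟪ω, σ⟫ + (‖σ‖² − ⟪ω, Pω⟫)` at `(t, x)` (from `Dω/Dt = σ` and Ohkitani's
`Dσ/Dt = −Pω`, `VortexStretchingDynamics.hasDerivAt_stretching_euler`).
[cite: GalantiGibbonHeritage1997, §2 (conv1) (arXiv:chao-dyn/9709003 p. 5)] -/
theorem hasDerivAt_inner_curl_stretching_euler (hu : ContDiffAt ℝ 2 (uncurry u) (t, x))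
    (hp : ContDiffAt ℝ 2 (p t) x)
    (hmom : ∀ᶠ y in 𝓝 x, deriv (fun s => u s y) t = -convect (u t) (u t) y - gradient (p t) y)
    (hvort : HasDerivAt (fun s => curl (u s) x)
      (-convect (u t) (curl (u t)) x + convect (curl (u t)) (u t) x) t) :
    HasDerivAt (fun s => ⟪curl (u s) x, fderiv ℝ (u s) x (curl (u s) x)⟫)
      (-(fderiv ℝ (fun y => ⟪curl (u t) y, fderiv ℝ (u t) y (curl (u t) y)⟫) x (u t x)) +
        (‖fderiv ℝ (u t) x (curl (u t) x)‖ ^ 2 -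
          ⟪curl (u t) x, fderiv ℝ (gradient (p t)) x (curl (u t) x)⟫)) t := by
  obtain ⟨hωd, hσd⟩ := differentiableAt_curl_and_stretching (contDiffAt_slice' hu)
  have hσ := hasDerivAt_stretching_euler hu hp hmom hvort
  have hsp : fderiv ℝ (fun y => ⟪curl (u t) y, fderiv ℝ (u t) y (curl (u t) y)⟫) x (u t x) =
      ⟪curl (u t) x, fderiv ℝ (fun y => fderiv ℝ (u t) y (curl (u t) y)) x (u t x)⟫ +
        ⟪fderiv ℝ (curl (u t)) x (u t x), fderiv ℝ (u t) x (curl (u t) x)⟫ := by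
    rw [(hωd.hasFDerivAt.inner ℝ hσd.hasFDerivAt).fderiv]
    simp only [ContinuousLinearMap.coe_comp, Function.comp_apply, ContinuousLinearMap.prod_apply,
      fderivInnerCLM_apply]
  refine (hvort.inner ℝ hσ).congr_deriv ?_
  rw [hsp, convect_apply, convect_apply]
  simp only [inner_add_left, inner_sub_right, inner_neg_left, inner_neg_right,
    real_inner_self_eq_norm_sq]
  ring

/-- **GGH97 (alphaev1) for Euler: `Dα/Dt = χ² − α² − α_p`** at a point with `ω(t, x) ≠ 0`, where
`α = ω·σ/|ω|²` (`= ξ·Sξ`, the stretching rate), `χ² = |ω × σ|²/|ω|⁴` (`= |ξ × Sξ|²`, the squared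
tilting), `α_p = ω·Pω/|ω|²` (`= ξ·Pξ`), `σ = ∇u ω`, `P = ∇²p`:
`∂ₜα = −(u·∇)α + (χ² − α² − α_p)` at `(t, x)` — "a set of non-autonomous ODEs, in the Lagrangian
picture … driven by `α_p` and `χ_p`". Proof as printed: quotient rule with (conv1) and
`D|ω|²/Dt = 2α|ω|²`, then `|σ|²/|ω|² = α² + χ²` (Lagrange, (cos)).
[cite: GalantiGibbonHeritage1997, §2 (alphaev1) (= §1 (alphaev)) (arXiv:chao-dyn/9709003 pp. 4–5)] -/
theorem hasDerivAt_stretchingRate_euler (hu : ContDiffAt ℝ 2 (uncurry u) (t, x))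
    (hp : ContDiffAt ℝ 2 (p t) x)
    (hmom : ∀ᶠ y in 𝓝 x, deriv (fun s => u s y) t = -convect (u t) (u t) y - gradient (p t) y)
    (hvort : HasDerivAt (fun s => curl (u s) x)
      (-convect (u t) (curl (u t)) x + convect (curl (u t)) (u t) x) t)
    (hx : curl (u t) x ≠ 0) :
    HasDerivAt
      (fun s => ⟪curl (u s) x, fderiv ℝ (u s) x (curl (u s) x)⟫ / ‖curl (u s) x‖ ^ 2)
      (-(fderiv ℝ (fun y => ⟪curl (u t) y, fderiv ℝ (u t) y (curl (u t) y)⟫ / ‖curl (u t) y‖ ^ 2)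
            x (u t x)) +
        (‖cross (curl (u t) x) (fderiv ℝ (u t) x (curl (u t) x))‖ ^ 2 / ‖curl (u t) x‖ ^ 4 -
          (⟪curl (u t) x, fderiv ℝ (u t) x (curl (u t) x)⟫ / ‖curl (u t) x‖ ^ 2) ^ 2 -
          ⟪curl (u t) x, fderiv ℝ (gradient (p t)) x (curl (u t) x)⟫ / ‖curl (u t) x‖ ^ 2)) t := by
  obtain ⟨hωd, hσd⟩ := differentiableAt_curl_and_stretching (contDiffAt_slice' hu)
  -- the time derivatives of numerator and denominator
  have hN := hasDerivAt_inner_curl_stretching_euler hu hp hmom hvort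
  have hD := hasDerivAt_norm_curl_sq_euler hu hvort
  have hD0 : ‖curl (u t) x‖ ^ 2 ≠ 0 := pow_ne_zero 2 (norm_ne_zero_iff.2 hx)
  have hα := hN.div hD hD0
  -- the spatial derivative of the quotient field `α = N/D`
  have hNsp : HasFDerivAt (fun y => ⟪curl (u t) y, fderiv ℝ (u t) y (curl (u t) y)⟫)
      (fderiv ℝ (fun y => ⟪curl (u t) y, fderiv ℝ (u t) y (curl (u t) y)⟫) x) x :=
    (hωd.hasFDerivAt.inner ℝ hσd.hasFDerivAt).differentiableAt.hasFDerivAt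
  have hDsp : HasFDerivAt (fun y => ‖curl (u t) y‖ ^ 2)
      (fderiv ℝ (fun y => ‖curl (u t) y‖ ^ 2) x) x :=
    hωd.hasFDerivAt.norm_sq.differentiableAt.hasFDerivAt
  have hinv : HasFDerivAt (fun y => (‖curl (u t) y‖ ^ 2)⁻¹)
      ((-((‖curl (u t) x‖ ^ 2) ^ 2)⁻¹) • fderiv ℝ (fun y => ‖curl (u t) y‖ ^ 2) x) x :=
    (hasDerivAt_inv hD0).comp_hasFDerivAt x hDsp
  have hquot : HasFDerivAt
      (fun y => ⟪curl (u t) y, fderiv ℝ (u t) y (curl (u t) y)⟫ * (‖curl (u t) y‖ ^ 2)⁻¹)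
      (⟪curl (u t) x, fderiv ℝ (u t) x (curl (u t) x)⟫ •
          ((-((‖curl (u t) x‖ ^ 2) ^ 2)⁻¹) • fderiv ℝ (fun y => ‖curl (u t) y‖ ^ 2) x) +
        (‖curl (u t) x‖ ^ 2)⁻¹ •
          fderiv ℝ (fun y => ⟪curl (u t) y, fderiv ℝ (u t) y (curl (u t) y)⟫) x) x :=
    hNsp.mul hinv
  have e : (fun y => ⟪curl (u t) y, fderiv ℝ (u t) y (curl (u t) y)⟫ / ‖curl (u t) y‖ ^ 2) =
      fun y => ⟪curl (u t) y, fderiv ℝ (u t) y (curl (u t) y)⟫ * (‖curl (u t) y‖ ^ 2)⁻¹ :=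
    funext fun y => div_eq_mul_inv _ _
  have hsp : fderiv ℝ (fun y => ⟪curl (u t) y, fderiv ℝ (u t) y (curl (u t) y)⟫ / ‖curl (u t) y‖ ^ 2)
      x (u t x) =
      ⟪curl (u t) x, fderiv ℝ (u t) x (curl (u t) x)⟫ *
          ((-((‖curl (u t) x‖ ^ 2) ^ 2)⁻¹) * fderiv ℝ (fun y => ‖curl (u t) y‖ ^ 2) x (u t x)) +
        (‖curl (u t) x‖ ^ 2)⁻¹ *
          fderiv ℝ (fun y => ⟪curl (u t) y, fderiv ℝ (u t) y (curl (u t) y)⟫) x (u t x) := by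
    rw [e, hquot.fderiv]
    simp only [add_apply, smul_apply, smul_eq_mul]
  -- Lagrange's identity `|ω × σ|² = |ω|²|σ|² − (ω·σ)²`
  have hL := norm_cross_sq (curl (u t) x) (fderiv ℝ (u t) x (curl (u t) x))
  refine hα.congr_deriv ?_
  rw [hsp, hL]
  -- abbreviate the scalar atoms
  set N : ℝ := ⟪curl (u t) x, fderiv ℝ (u t) x (curl (u t) x)⟫
  set D : ℝ := ‖curl (u t) x‖ ^ 2
  set Nu : ℝ := fderiv ℝ (fun y => ⟪curl (u t) y, fderiv ℝ (u t) y (curl (u t) y)⟫) x (u t x)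
  set Du : ℝ := fderiv ℝ (fun y => ‖curl (u t) y‖ ^ 2) x (u t x)
  set S2 : ℝ := ‖fderiv ℝ (u t) x (curl (u t) x)‖ ^ 2
  set Pw : ℝ := ⟪curl (u t) x, fderiv ℝ (gradient (p t)) x (curl (u t) x)⟫
  have hD4 : ‖curl (u t) x‖ ^ 4 = D ^ 2 := by rw [← pow_mul]
  rw [hD4]
  field_simp
  ring

/-- **GGH97 (chiidef) for Euler: `Dχ/Dt = −2αχ − χ_p`** (vector form) at a point with
`ω(t, x) ≠ 0`, where `χ = ω × σ/|ω|²` (`= ξ × Sξ`, the tilting vector), `α = ω·σ/|ω|²`,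
`χ_p = ω × Pω/|ω|²` (`= ξ × Pξ`), `σ = ∇u ω`, `P = ∇²p`:
`∂ₜχ = −(u·∇)χ + (−2αχ − χ_p)` at `(t, x)` (quotient rule with (conv2) and `D|ω|²/Dt = 2α|ω|²`).
[cite: GalantiGibbonHeritage1997, §2 (chiidef) (= §1 (chi0)) (arXiv:chao-dyn/9709003 pp. 4–5)] -/
theorem hasDerivAt_tiltingVector_euler (hu : ContDiffAt ℝ 2 (uncurry u) (t, x))
    (hp : ContDiffAt ℝ 2 (p t) x)
    (hmom : ∀ᶠ y in 𝓝 x, deriv (fun s => u s y) t = -convect (u t) (u t) y - gradient (p t) y)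
    (hvort : HasDerivAt (fun s => curl (u s) x)
      (-convect (u t) (curl (u t)) x + convect (curl (u t)) (u t) x) t)
    (hx : curl (u t) x ≠ 0) :
    HasDerivAt
      (fun s => (‖curl (u s) x‖ ^ 2)⁻¹ • cross (curl (u s) x) (fderiv ℝ (u s) x (curl (u s) x)))
      (-(fderiv ℝ (fun y => (‖curl (u t) y‖ ^ 2)⁻¹ •
              cross (curl (u t) y) (fderiv ℝ (u t) y (curl (u t) y))) x (u t x)) +
        (-(2 * (⟪curl (u t) x, fderiv ℝ (u t) x (curl (u t) x)⟫ / ‖curl (u t) x‖ ^ 2)) •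
            ((‖curl (u t) x‖ ^ 2)⁻¹ • cross (curl (u t) x) (fderiv ℝ (u t) x (curl (u t) x))) -
          (‖curl (u t) x‖ ^ 2)⁻¹ •
            cross (curl (u t) x) (fderiv ℝ (gradient (p t)) x (curl (u t) x)))) t := by
  obtain ⟨hωd, hσd⟩ := differentiableAt_curl_and_stretching (contDiffAt_slice' hu)
  have hC := hasDerivAt_cross_stretching_euler hu hp hmom hvort
  have hD := hasDerivAt_norm_curl_sq_euler hu hvort
  have hD0 : ‖curl (u t) x‖ ^ 2 ≠ 0 := pow_ne_zero 2 (norm_ne_zero_iff.2 hx)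
  have hDinv : HasDerivAt (fun s => (‖curl (u s) x‖ ^ 2)⁻¹)
      (-((‖curl (u t) x‖ ^ 2) ^ 2)⁻¹ *
        (-(fderiv ℝ (fun y => ‖curl (u t) y‖ ^ 2) x (u t x)) +
          2 * ⟪curl (u t) x, fderiv ℝ (u t) x (curl (u t) x)⟫)) t :=
    (hasDerivAt_inv hD0).comp t hD
  have hχ := hDinv.smul hC
  -- spatial derivative of `χ = D⁻¹ • (ω × σ)`
  have hCd : DifferentiableAt ℝ (fun y => cross (curl (u t) y) (fderiv ℝ (u t) y (curl (u t) y))) x :=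
    (hasFDerivAt_cross hωd.hasFDerivAt hσd.hasFDerivAt).differentiableAt
  have hCsp : HasFDerivAt (fun y => cross (curl (u t) y) (fderiv ℝ (u t) y (curl (u t) y)))
      (fderiv ℝ (fun y => cross (curl (u t) y) (fderiv ℝ (u t) y (curl (u t) y))) x) x :=
    hCd.hasFDerivAt
  have hDsp : HasFDerivAt (fun y => ‖curl (u t) y‖ ^ 2)
      (fderiv ℝ (fun y => ‖curl (u t) y‖ ^ 2) x) x :=
    hωd.hasFDerivAt.norm_sq.differentiableAt.hasFDerivAt
  have hinv : HasFDerivAt (fun y => (‖curl (u t) y‖ ^ 2)⁻¹)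
      ((-((‖curl (u t) x‖ ^ 2) ^ 2)⁻¹) • fderiv ℝ (fun y => ‖curl (u t) y‖ ^ 2) x) x :=
    (hasDerivAt_inv hD0).comp_hasFDerivAt x hDsp
  have hquot : HasFDerivAt
      (fun y => (‖curl (u t) y‖ ^ 2)⁻¹ • cross (curl (u t) y) (fderiv ℝ (u t) y (curl (u t) y)))
      ((‖curl (u t) x‖ ^ 2)⁻¹ •
          fderiv ℝ (fun y => cross (curl (u t) y) (fderiv ℝ (u t) y (curl (u t) y))) x +
        ((-((‖curl (u t) x‖ ^ 2) ^ 2)⁻¹) • fderiv ℝ (fun y => ‖curl (u t) y‖ ^ 2) x).smulRight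
          (cross (curl (u t) x) (fderiv ℝ (u t) x (curl (u t) x)))) x :=
    hinv.smul hCsp
  have hsp : fderiv ℝ (fun y => (‖curl (u t) y‖ ^ 2)⁻¹ •
        cross (curl (u t) y) (fderiv ℝ (u t) y (curl (u t) y))) x (u t x) =
      (‖curl (u t) x‖ ^ 2)⁻¹ •
          fderiv ℝ (fun y => cross (curl (u t) y) (fderiv ℝ (u t) y (curl (u t) y))) x (u t x) +
        ((-((‖curl (u t) x‖ ^ 2) ^ 2)⁻¹) * fderiv ℝ (fun y => ‖curl (u t) y‖ ^ 2) x (u t x)) •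
          cross (curl (u t) x) (fderiv ℝ (u t) x (curl (u t) x)) := by
    rw [hquot.fderiv]
    simp only [add_apply, smul_apply, ContinuousLinearMap.smulRight_apply, smul_eq_mul]
  refine hχ.congr_deriv ?_
  rw [hsp]
  -- abbreviate
  set D : ℝ := ‖curl (u t) x‖ ^ 2 with hDdef
  set N : ℝ := ⟪curl (u t) x, fderiv ℝ (u t) x (curl (u t) x)⟫
  set Du : ℝ := fderiv ℝ (fun y => ‖curl (u t) y‖ ^ 2) x (u t x)
  set C : EuclideanSpace ℝ (Fin 3) := cross (curl (u t) x) (fderiv ℝ (u t) x (curl (u t) x))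
  set Cu : EuclideanSpace ℝ (Fin 3) :=
    fderiv ℝ (fun y => cross (curl (u t) y) (fderiv ℝ (u t) y (curl (u t) y))) x (u t x)
  set CP : EuclideanSpace ℝ (Fin 3) := cross (curl (u t) x) (fderiv ℝ (gradient (p t)) x (curl (u t) x))
  simp only [smul_sub, smul_neg, smul_smul]
  match_scalars <;> ring

end Euler

end VortexStretchingDynamics

end Literature.Analysis.FluidPDE
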